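import Summits.Ventures.PercRepro.Night2NearFatFair

/-!
# night-2: THE NON-SUSPECT FAMILY WITH THE SIX-LINE EXCLUSION (gen 40)

The family of Night2NearFatFair with one more exclusion at the start level `s`: the targets `Y ⊇ L₀` (`L₀` = the `W`-part of the
unique six-point three-planar line, Night2NearFatSixLine) — at `|W| = 10` these are the only distance-2 loads at level `6`
(Night2NearFatTop: a distance-2 load has level `≤ |W| − 4`, and at that level its line has exactly `|V| − 9` points).
`ntpIncomeX N s d₁ d₂ e₁ e₂ x` subtracts `x` more suspects at level `s`; `card_filter_superset_le` bounds the supersets of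
`L₀` by `C(|W ∖ L₀|, s − |L₀|)`; **`basis_pair_fair_of_ntpX`** is the fair-share theorem.  Paper: proofs/NIGHT-2-g40.md §9.
-/

namespace PercRepro.Shadow

open PercRepro.ThmH PercRepro.PerFlat

variable {α : Type*} [DecidableEq α] {M : Matroid α} [M.Finite] {G : Finset α}

/-- The income from the start level `s` with `x` more suspects excluded at level `s`. -/
noncomputable def ntpIncomeX (N s d₁ d₂ e₁ e₂ x : ℕ) : ℚ :=
  ∑ i ∈ Finset.range (N + 1), if s ≤ i then
    (if N ≤ i + 3 then (1 : ℚ) else 11 / 18) *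
      max 0 (((N.choose i : ℕ) : ℚ) - (if N ≤ i + 3 then (0 : ℚ) else 5 * (((N - 2).choose i : ℕ) : ℚ)) -
        ((suspBound N i d₁ d₂ e₁ e₂ + (if i = s then x else 0) : ℕ) : ℚ)) * 3 / (((i + 5).choose 4 : ℕ) : ℚ)
  else 0

omit [DecidableEq α] in
/-- **The supersets of `L` of size `i`** in `W` number at most `C(|W ∖ L|, i − |L|)`. -/
theorem card_filter_superset_le [DecidableEq α] (W L : Finset α) (i : ℕ) :
    ((W.powersetCard i).filter (fun Y => L ⊆ Y)).card ≤ (W \ L).card.choose (i - L.card) := by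
  have hsub : (W.powersetCard i).filter (fun Y => L ⊆ Y) ⊆
      ((W \ L).powersetCard (i - L.card)).image (fun Z => L ∪ Z) := by
    intro Y hY
    rw [Finset.mem_filter, Finset.mem_powersetCard] at hY
    obtain ⟨⟨hYW, hYi⟩, hLY⟩ := hY
    rw [Finset.mem_image]
    refine ⟨Y \ L, ?_, ?_⟩
    · rw [Finset.mem_powersetCard]
      refine ⟨fun v hv => Finset.mem_sdiff.2 ⟨hYW (Finset.mem_sdiff.1 hv).1, (Finset.mem_sdiff.1 hv).2⟩, ?_⟩
      rw [Finset.card_sdiff_of_subset hLY, hYi]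
    · rw [Finset.union_sdiff_of_subset hLY]
  refine le_trans (Finset.card_le_card hsub) ?_
  refine le_trans Finset.card_image_le ?_
  rw [Finset.card_powersetCard]

omit [DecidableEq α] in
/-- **The abstract regrouping from the start level `s`.** -/
theorem ntpIncomeX_le_sum_filter (W : Finset α) (P : Finset α → Prop) [DecidablePred P] (s d₁ d₂ e₁ e₂ x : ℕ)
    (hcount : ∀ i, s ≤ i →
      ((W.card.choose i : ℕ) : ℚ) - (if W.card ≤ i + 3 then (0 : ℚ) else 5 * (((W.card - 2).choose i : ℕ) : ℚ)) -
        ((suspBound W.card i d₁ d₂ e₁ e₂ + (if i = s then x else 0) : ℕ) : ℚ) ≤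
          (((W.powersetCard i).filter P).card : ℚ)) :
    ntpIncomeX W.card s d₁ d₂ e₁ e₂ x ≤
      ∑ Y ∈ W.powerset.filter (fun Y => s ≤ Y.card ∧ P Y),
        (if W.card ≤ Y.card + 3 then (1 : ℚ) else 11 / 18) * 3 / (((Y.card + 5).choose 4 : ℕ) : ℚ) := by
  set fam : Finset (Finset α) := W.powerset.filter (fun Y => s ≤ Y.card ∧ P Y) with hfam
  have hmaps : ∀ Y ∈ fam, Y.card ∈ Finset.range (W.card + 1) := fun Y hY =>
    Finset.mem_range.2 (Nat.lt_succ_of_le (Finset.card_le_card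
      (Finset.mem_powerset.1 (Finset.mem_filter.1 hY).1)))
  have hfiber := Finset.sum_fiberwise_of_maps_to hmaps
    (fun Y => (if W.card ≤ Y.card + 3 then (1 : ℚ) else 11 / 18) * 3 / (((Y.card + 5).choose 4 : ℕ) : ℚ))
  rw [← hfiber]
  unfold ntpIncomeX
  apply Finset.sum_le_sum
  intro i _
  have hfib : ∑ Y ∈ fam.filter (fun Y => Y.card = i),
      (if W.card ≤ Y.card + 3 then (1 : ℚ) else 11 / 18) * 3 / (((Y.card + 5).choose 4 : ℕ) : ℚ) =
      ((fam.filter (fun Y => Y.card = i)).card : ℚ) *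
        ((if W.card ≤ i + 3 then (1 : ℚ) else 11 / 18) * 3 / (((i + 5).choose 4 : ℕ) : ℚ)) := by
    rw [Finset.sum_congr rfl (fun Y hY => by rw [(Finset.mem_filter.1 hY).2])]
    rw [Finset.sum_const, nsmul_eq_mul]
  rw [hfib]
  by_cases hsi : s ≤ i
  · rw [if_pos hsi]
    have hsub : (W.powersetCard i).filter P ⊆ fam.filter (fun Y => Y.card = i) := by
      intro Y hY
      rw [Finset.mem_filter, Finset.mem_powersetCard] at hY
      obtain ⟨⟨hYW, hYi⟩, hP⟩ := hY
      rw [Finset.mem_filter, hfam, Finset.mem_filter, Finset.mem_powerset]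
      exact ⟨⟨hYW, by omega, hP⟩, hYi⟩
    have hcard : (((W.powersetCard i).filter P).card : ℚ) ≤ ((fam.filter (fun Y => Y.card = i)).card : ℚ) := by
      exact_mod_cast Finset.card_le_card hsub
    set w : ℚ := (if W.card ≤ i + 3 then (1 : ℚ) else 11 / 18) with hw
    set c : ℚ := (if W.card ≤ i + 3 then (0 : ℚ) else 5 * (((W.card - 2).choose i : ℕ) : ℚ)) with hc
    have hw0 : 0 ≤ w := by
      rw [hw]
      split_ifs <;> norm_num
    have hC : (0 : ℚ) ≤ w * 3 / (((i + 5).choose 4 : ℕ) : ℚ) := by positivity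
    have hmax : max 0 (((W.card.choose i : ℕ) : ℚ) - c - ((suspBound W.card i d₁ d₂ e₁ e₂ + (if i = s then x else 0) : ℕ) : ℚ)) ≤
        ((fam.filter (fun Y => Y.card = i)).card : ℚ) :=
      max_le (by positivity) (le_trans (hcount i hsi) hcard)
    calc w * max 0 (((W.card.choose i : ℕ) : ℚ) - c - ((suspBound W.card i d₁ d₂ e₁ e₂ + (if i = s then x else 0) : ℕ) : ℚ)) * 3 /
          (((i + 5).choose 4 : ℕ) : ℚ)
        = max 0 (((W.card.choose i : ℕ) : ℚ) - c - ((suspBound W.card i d₁ d₂ e₁ e₂ + (if i = s then x else 0) : ℕ) : ℚ)) *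
            (w * 3 / (((i + 5).choose 4 : ℕ) : ℚ)) := by ring
      _ ≤ ((fam.filter (fun Y => Y.card = i)).card : ℚ) * (w * 3 / (((i + 5).choose 4 : ℕ) : ℚ)) :=
          mul_le_mul_of_nonneg_right hmax hC
  · rw [if_neg hsi]
    have hw0 : (0 : ℚ) ≤ (if W.card ≤ i + 3 then (1 : ℚ) else 11 / 18) := by
      split_ifs <;> norm_num
    positivity

/-- **The non-suspect top-or-hitting targets from the start level `s` avoiding the six-line supersets at level `s`** are
targets of income at least `ntpIncomeX N s |ℓ₁| |ℓ₂| |C₁| |C₂| x` (every one of them unloaded by hypothesis). -/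
theorem ntpX_targets_subset_and_income (hG : G ∈ flatsQ M (5 + 1)) (hd : (gr M \ G).card = 2)
    (hk : kColoops M G = 1) (hnf : fatClosures M 5 G 2 = ∅)
    {B : Finset α} (hB : B ∈ thinMembers M 5 G) (hnP : ¬ bigP M G B) {z : α} (hz : z ∈ G \ clF M B)
    (hl0 : loss M 5 G B z ≠ 0) {ℓ₁ ℓ₂ C₁ C₂ L₀ : Finset α} {s x : ℕ} (hs1 : 1 ≤ s)
    (hx : (((G \ insert z B).powersetCard s).filter (fun Y => L₀ ⊆ Y)).card ≤ x)
    (hdl : ∀ Y ⊆ G \ insert z B, s ≤ Y.card →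
      ¬ ((∃ a ∈ insert z B \ coloops M G, ∃ b ∈ insert z B \ coloops M G, a ≠ b ∧
          Y.card ≤ (Y ∩ clF M {a, b}).card + 1) ∨
        ∃ a ∈ insert z B \ coloops M G, ∃ y ∈ Y, Y ⊆ clF M {a, y}) →
      ¬ (Y.card = s ∧ L₀ ⊆ Y) →
      dload M 5 G (bigP M G) (dshGT2 M 5 G) (insert z B ∪ Y) = 0)
    (hℓ₁ : ℓ₁ ⊆ G \ insert z B) (hℓ₂ : ℓ₂ ⊆ G \ insert z B)
    (hB2 : ∀ a ∈ insert z B \ coloops M G, ∀ b ∈ insert z B \ coloops M G, a ≠ b →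
      (G \ insert z B) ∩ clF M {a, b} ⊆ ℓ₁ ∨ (G \ insert z B) ∩ clF M {a, b} ⊆ ℓ₂ ∨
        ((G \ insert z B) ∩ clF M {a, b}).card + 2 ≤ s)
    (hB1 : ∀ a ∈ insert z B \ coloops M G, ∀ y ∈ G \ insert z B,
      (G \ insert z B) ∩ clF M {a, y} ⊆ C₁ ∨ (G \ insert z B) ∩ clF M {a, y} ⊆ C₂ ∨
        ((G \ insert z B) ∩ clF M {a, y}).card + 1 ≤ s) :
    (((G \ insert z B).powerset.filter (fun Y => s ≤ Y.card ∧
        (¬ ((∃ a ∈ insert z B \ coloops M G, ∃ b ∈ insert z B \ coloops M G, a ≠ b ∧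
            Y.card ≤ (Y ∩ clF M {a, b}).card + 1) ∨
          ∃ a ∈ insert z B \ coloops M G, ∃ y ∈ Y, Y ⊆ clF M {a, y}) ∧
        ¬ (Y.card = s ∧ L₀ ⊆ Y) ∧
        ((G \ insert z B).card ≤ Y.card + 3 ∨
          ∀ w ∈ (insert z B \ coloops M G).filter (fun w => faceOk M G (insert z B) w),
            ¬ Y ⊆ clF M ((insert z B).erase w))))).image (fun Y => insert z B ∪ Y)) ⊆ tgtSets M 5 G B z ∧
      ntpIncomeX (G \ insert z B).card s ℓ₁.card ℓ₂.card C₁.card C₂.card x ≤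
        ∑ T ∈ ((G \ insert z B).powerset.filter (fun Y => s ≤ Y.card ∧
          (¬ ((∃ a ∈ insert z B \ coloops M G, ∃ b ∈ insert z B \ coloops M G, a ≠ b ∧
              Y.card ≤ (Y ∩ clF M {a, b}).card + 1) ∨
            ∃ a ∈ insert z B \ coloops M G, ∃ y ∈ Y, Y ⊆ clF M {a, y}) ∧
          ¬ (Y.card = s ∧ L₀ ⊆ Y) ∧
          ((G \ insert z B).card ≤ Y.card + 3 ∨
            ∀ w ∈ (insert z B \ coloops M G).filter (fun w => faceOk M G (insert z B) w),
              ¬ Y ⊆ clF M ((insert z B).erase w))))).image (fun Y => insert z B ∪ Y),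
          vCap M G T / faceSum M G T := by
  set W := G \ insert z B with hW
  set Susp : Finset α → Prop := fun Y =>
    (∃ a ∈ insert z B \ coloops M G, ∃ b ∈ insert z B \ coloops M G, a ≠ b ∧
      Y.card ≤ (Y ∩ clF M {a, b}).card + 1) ∨
    ∃ a ∈ insert z B \ coloops M G, ∃ y ∈ Y, Y ⊆ clF M {a, y} with hSusp
  set Six : Finset α → Prop := fun Y => Y.card = s ∧ L₀ ⊆ Y with hSix
  set Hit : Finset α → Prop := fun Y =>
    ∀ w ∈ (insert z B \ coloops M G).filter (fun w => faceOk M G (insert z B) w),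
      ¬ Y ⊆ clF M ((insert z B).erase w) with hHit
  set P : Finset α → Prop := fun Y => ¬ Susp Y ∧ ¬ Six Y ∧ (W.card ≤ Y.card + 3 ∨ Hit Y) with hP
  set fam : Finset (Finset α) := W.powerset.filter (fun Y => s ≤ Y.card ∧ P Y) with hfam
  set 𝒯 : Finset (Finset α) := fam.image (fun Y => insert z B ∪ Y) with h𝒯
  have hmem : ∀ Y ∈ fam, Y ⊆ W ∧ s ≤ Y.card ∧ P Y := by
    intro Y hY
    rw [hfam, Finset.mem_filter, Finset.mem_powerset] at hY
    exact ⟨hY.1, hY.2.1, hY.2.2⟩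
  have h𝒯sub : 𝒯 ⊆ tgtSets M 5 G B z := by
    intro T hT
    rw [h𝒯, Finset.mem_image] at hT
    obtain ⟨Y, hY, rfl⟩ := hT
    obtain ⟨hYW, hYc, -⟩ := hmem Y hY
    rw [tgtSets_eq_image hG (mem_thinMembers.1 hB).1 hz, Finset.mem_image]
    refine ⟨Y, Finset.mem_filter.2 ⟨Finset.mem_powerset.2 hYW, ?_⟩, rfl⟩
    rw [← Finset.card_pos]
    omega
  have hinj : Set.InjOn (fun Y => insert z B ∪ Y) (fam : Set (Finset α)) := by
    intro Y₁ hY₁ Y₂ hY₂ heq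
    rw [Finset.mem_coe] at hY₁ hY₂
    have key : ∀ Y ∈ fam, (insert z B ∪ Y) ∩ W = Y := by
      intro Y hY
      ext x
      rw [Finset.mem_inter, Finset.mem_union]
      constructor
      · rintro ⟨hx | hx, hxW⟩
        · exact absurd hx (Finset.mem_sdiff.1 hxW).2
        · exact hx
      · intro hx
        exact ⟨Or.inr hx, (hmem Y hY).1 hx⟩
    have h1 := key Y₁ hY₁
    have h2 := key Y₂ hY₂
    simp only at heq
    rw [← h1, ← h2, heq]
  have hterm : ∀ Y ∈ fam, (if W.card ≤ Y.card + 3 then (1 : ℚ) else 11 / 18) * 3 /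
      (((Y.card + 5).choose 4 : ℕ) : ℚ) ≤ vCap M G (insert z B ∪ Y) / faceSum M G (insert z B ∪ Y) := by
    intro Y hY
    obtain ⟨hYW, hYc, hnS, hnSix, hYtop⟩ := hmem Y hY
    have hne : Y.Nonempty := by
      rw [← Finset.card_pos]
      omega
    exact free_term hG hd hk hnf hB hnP hz hl0 hYW hne (hdl Y hYW hYc hnS hnSix) hYtop
  have hsum𝒯 : ∑ Y ∈ fam, (if W.card ≤ Y.card + 3 then (1 : ℚ) else 11 / 18) * 3 /
      (((Y.card + 5).choose 4 : ℕ) : ℚ) ≤ ∑ T ∈ 𝒯, vCap M G T / faceSum M G T := by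
    rw [h𝒯, Finset.sum_image hinj]
    exact Finset.sum_le_sum hterm
  refine ⟨h𝒯sub, le_trans ?_ hsum𝒯⟩
  apply ntpIncomeX_le_sum_filter W P s
  intro i hsi
  have hSusp := card_filter_suspect_basis_le hs1 hℓ₁ hℓ₂ hB2 hB1 hsi
  -- the suspects together with the six-line supersets
  have hSS : (((W.powersetCard i).filter (fun Y => Susp Y ∨ Six Y)).card : ℚ) ≤
      ((suspBound W.card i ℓ₁.card ℓ₂.card C₁.card C₂.card + (if i = s then x else 0) : ℕ) : ℚ) := by
    have hsub : (W.powersetCard i).filter (fun Y => Susp Y ∨ Six Y) ⊆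
        (W.powersetCard i).filter Susp ∪ (W.powersetCard i).filter Six := by
      intro Y hY
      rw [Finset.mem_filter] at hY
      rw [Finset.mem_union, Finset.mem_filter, Finset.mem_filter]
      rcases hY.2 with h | h
      · exact Or.inl ⟨hY.1, h⟩
      · exact Or.inr ⟨hY.1, h⟩
    have hSixc : ((W.powersetCard i).filter Six).card ≤ (if i = s then x else 0) := by
      by_cases his : i = s
      · rw [if_pos his]
        subst his
        refine le_trans (Finset.card_le_card ?_) hx
        intro Y hY
        rw [Finset.mem_filter] at hY ⊢
        exact ⟨hY.1, hY.2.2⟩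
      · rw [if_neg his]
        apply Nat.le_of_eq
        rw [Finset.card_eq_zero, Finset.eq_empty_iff_forall_notMem]
        intro Y hY
        rw [Finset.mem_filter, Finset.mem_powersetCard] at hY
        exact his (hY.1.2 ▸ hY.2.1)
    have h := le_trans (Finset.card_le_card hsub) (Finset.card_union_le _ _)
    have h' : ((W.powersetCard i).filter Susp).card + ((W.powersetCard i).filter Six).card ≤
        suspBound W.card i ℓ₁.card ℓ₂.card C₁.card C₂.card + (if i = s then x else 0) :=
      Nat.add_le_add hSusp hSixc
    exact_mod_cast le_trans h h'
  by_cases htop : W.card ≤ i + 3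
  · rw [if_pos htop]
    have hsplit := Finset.card_filter_add_card_filter_not (s := W.powersetCard i) (fun Y => Susp Y ∨ Six Y)
    rw [Finset.card_powersetCard] at hsplit
    have hsub : (W.powersetCard i).filter (fun Y => ¬ (Susp Y ∨ Six Y)) ⊆ (W.powersetCard i).filter P := by
      intro Y hY
      rw [Finset.mem_filter] at hY ⊢
      have hYi : Y.card = i := (Finset.mem_powersetCard.1 hY.1).2
      rw [not_or] at hY
      exact ⟨hY.1, hY.2.1, hY.2.2, Or.inl (by omega)⟩
    have h1 : (((W.powersetCard i).filter (fun Y => ¬ (Susp Y ∨ Six Y))).card : ℚ) ≤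
        (((W.powersetCard i).filter P).card : ℚ) := by exact_mod_cast Finset.card_le_card hsub
    have h2 : (((W.powersetCard i).filter (fun Y => Susp Y ∨ Six Y)).card : ℚ) +
        (((W.powersetCard i).filter (fun Y => ¬ (Susp Y ∨ Six Y))).card : ℚ) = ((W.card.choose i : ℕ) : ℚ) := by
      exact_mod_cast hsplit
    linarith
  · rw [if_neg htop]
    have hQG : insert z B ⊆ G :=
      Finset.insert_subset (Finset.mem_sdiff.1 hz).1 (subset_G_of_mem_thinMembers hB)
    have hC : ∀ w ∈ (insert z B \ coloops M G).filter (fun w => faceOk M G (insert z B) w),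
        (clF M ((insert z B).erase w) ∩ W).card + 2 ≤ W.card := by
      intro w hw
      have hok := (Finset.mem_filter.1 hw).2
      have h2 : 2 ≤ (W \ clF M ((insert z B).erase w)).card := two_le_card_holes hG hnf hQG hok
      have hsplit := Finset.card_sdiff_add_card_inter W (clF M ((insert z B).erase w))
      rw [Finset.inter_comm]
      omega
    have hA : ((insert z B \ coloops M G).filter (fun w => faceOk M G (insert z B) w)).card ≤ 5 := by
      obtain ⟨-, hQ'5⟩ := rkN_insert_sdiff_coloops_eq_five hG hd hk hB hnP hz
      rw [← hQ'5]
      exact Finset.card_filter_le _ _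
    have hA' : (((insert z B \ coloops M G).filter (fun w => faceOk M G (insert z B) w)).card : ℚ) ≤ 5 := by
      exact_mod_cast hA
    have h := card_filter_good_ge W ((insert z B \ coloops M G).filter (fun w => faceOk M G (insert z B) w))
      (fun w => clF M ((insert z B).erase w)) hC (fun Y => Susp Y ∨ Six Y) i
    have hsub : (W.powersetCard i).filter (fun Y => ¬ (Susp Y ∨ Six Y) ∧
        ∀ w ∈ (insert z B \ coloops M G).filter (fun w => faceOk M G (insert z B) w),
          ¬ Y ⊆ clF M ((insert z B).erase w)) ⊆ (W.powersetCard i).filter P := by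
      intro Y hY
      rw [Finset.mem_filter] at hY ⊢
      rw [not_or] at hY
      exact ⟨hY.1, hY.2.1.1, hY.2.1.2, Or.inr hY.2.2⟩
    have h1 : ((((W.powersetCard i).filter (fun Y => ¬ (Susp Y ∨ Six Y) ∧
        ∀ w ∈ (insert z B \ coloops M G).filter (fun w => faceOk M G (insert z B) w),
          ¬ Y ⊆ clF M ((insert z B).erase w))).card : ℕ) : ℚ) ≤
        (((W.powersetCard i).filter P).card : ℚ) := by exact_mod_cast Finset.card_le_card hsub
    have h0 : (0 : ℚ) ≤ (((W.card - 2).choose i : ℕ) : ℚ) := by positivity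
    nlinarith

/-- **THE NON-SUSPECT FAMILY THEOREM WITH THE SIX-LINE EXCLUSION**: `1 ≤ ntpIncomeX N s |ℓ₁| |ℓ₂| |C₁| |C₂| x` ⇒ the basis
pair is fair. -/
theorem basis_pair_fair_of_ntpX (hG : G ∈ flatsQ M (5 + 1)) (hd : (gr M \ G).card = 2)
    (hk : kColoops M G = 1) (hs : ∀ e ∈ gr M, ∀ f ∈ gr M, e ≠ f → rkN M {e, f} = 2)
    (hl : ∀ e ∈ gr M, M.Indep {e}) (hnf : fatClosures M 5 G 2 = ∅)
    {B : Finset α} (hB : B ∈ thinMembers M 5 G) (hnP : ¬ bigP M G B) {z : α} (hz : z ∈ G \ clF M B)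
    (hl0 : loss M 5 G B z ≠ 0) {ℓ₁ ℓ₂ C₁ C₂ L₀ : Finset α} {s x : ℕ} (hs1 : 1 ≤ s)
    (hx : (((G \ insert z B).powersetCard s).filter (fun Y => L₀ ⊆ Y)).card ≤ x)
    (hdl : ∀ Y ⊆ G \ insert z B, s ≤ Y.card →
      ¬ ((∃ a ∈ insert z B \ coloops M G, ∃ b ∈ insert z B \ coloops M G, a ≠ b ∧
          Y.card ≤ (Y ∩ clF M {a, b}).card + 1) ∨
        ∃ a ∈ insert z B \ coloops M G, ∃ y ∈ Y, Y ⊆ clF M {a, y}) →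
      ¬ (Y.card = s ∧ L₀ ⊆ Y) →
      dload M 5 G (bigP M G) (dshGT2 M 5 G) (insert z B ∪ Y) = 0)
    (hℓ₁ : ℓ₁ ⊆ G \ insert z B) (hℓ₂ : ℓ₂ ⊆ G \ insert z B)
    (hB2 : ∀ a ∈ insert z B \ coloops M G, ∀ b ∈ insert z B \ coloops M G, a ≠ b →
      (G \ insert z B) ∩ clF M {a, b} ⊆ ℓ₁ ∨ (G \ insert z B) ∩ clF M {a, b} ⊆ ℓ₂ ∨
        ((G \ insert z B) ∩ clF M {a, b}).card + 2 ≤ s)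
    (hB1 : ∀ a ∈ insert z B \ coloops M G, ∀ y ∈ G \ insert z B,
      (G \ insert z B) ∩ clF M {a, y} ⊆ C₁ ∨ (G \ insert z B) ∩ clF M {a, y} ⊆ C₂ ∨
        ((G \ insert z B) ∩ clF M {a, y}).card + 1 ≤ s)
    (hsum : 1 ≤ ntpIncomeX (G \ insert z B).card s ℓ₁.card ℓ₂.card C₁.card C₂.card x) :
    loss M 5 G B z ≤ rhoL M 5 G B z * lossIncomeH M 5 G (bigP M G) (dshGT2 M 5 G) B z := by
  have hfat : (fatClosures M 5 G 2).card ≤ 1 := by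
    rw [hnf, Finset.card_empty]
    exact zero_le_one
  obtain ⟨hsub, hinc⟩ := ntpX_targets_subset_and_income hG hd hk hnf hB hnP hz hl0 hs1 hx hdl hℓ₁ hℓ₂ hB2 hB1
  exact basis_pair_fair_of_vCap_face_sum_subfamily hG hd hk hs hl hfat hB hnP hz hl0 hsub (hsum.trans hinc)

end PercRepro.Shadow
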